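import Summits.NavierStokesRegularity.FunctionalMining.StretchingLaminateUnconditional
import Summits.NavierStokesRegularity.FunctionalMining.StretchingLaminateConst
import HarnessLib

/-!
# K1-Q1 laminates: DAG-NATIVE certificates — a state-indexed dynamic programme over a SHARED
lamination graph, its kernel checker, and the proof that a passing check is a `Tree` certificate

NS FUNCTIONAL MINING cell (`pub-nsfunc`), prove seat gen 15, 2026-08-21 — **search for candidate a
priori estimates; no regularity claim.** STATIC bookkeeping only: nothing about Navier–Stokes solutions
is asserted anywhere in this file.

WHY. The tree certificates `Laminate.Tree.cert` (`StretchingLaminates`) are evaluated by `decide +kernel`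
by UNFOLDING the tree: the kernel visits every occurrence of a sub-laminate, because `Tree.stretchFrom G W t`
carries the incoming state `G` and weight `W` of the occurrence (prove g14 PORT-NOTES §1–§3: one
declaration evaluates ≲ 4.3k node visits; the bank's K = 14 policy tree has 8 677 splits and needed the
9-file split certificate `StretchingLaminateRecord5*`; the K = 32 policy — r = 0.68232 — unfolds to
1 628 797 splits and is out of reach that way). But the bank's optimal laminates are POLICIES: the split
at a node depends only on its absolute state `G`, so the unfolded tree is the unfolding of a small DAG
of STATES (K = 16: 1 261 internal states for 26 845 splits; K = 32: 2 937 for 1.6 M; bank g13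
`tools/lam/runs/g13/dag/hub<K>_dag.json`, dict CHECK4). Since `stretchFrom G W t = W · stretchFrom G 1 t`
(`Tree.stretchFrom_eq_mul`), the three statistics of the sub-laminate below a state are STATE functions
and satisfy the one-step recursion `σ(v) = λ σ(v⁺) + (1−λ) σ(v⁻)`, `E` likewise, `M²(v) = max`; a
single bottom-up pass over the states evaluates the whole laminate — kernel work LINEAR in the number of
states, not in the size of the unfolded tree.

WHAT IS HERE (all `def`s computable, evaluated by `decide +kernel`; all theorems kernel-checked):
* `Dag.Node` = (absolute incoming state `G : Grad`, `Split`, two child references `Child.lf | Child.nd j`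
  to EARLIER nodes), a DAG = `List Dag.Node` in children-first order, root LAST;
* `Dag.Store` — a binary-trie random-access store (little-endian bit paths; `get`/`set`, `O(log i)` per
  access, structural recursion only) with its specification `Dag.Store.get_set`;
* `Dag.step` / `Dag.run` / **`Dag.check nodes r : Bool`** — the dynamic programme: for node `i` look up
  the two children (a referenced node must be `< i` and its stored state must EQUAL the pushed state
  `G.layer (1−λ) s` / `G.layer (−λ) s`; a leaf child is evaluated in place), check `0 < λ < 1`, `c·n = 0`,
  store `(G, σ, E, M²)`; finally the root must sit at `G = 0` and `r²E²M² ≤ σ²` with the signs of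
  `Tree.cert`;
* `Dag.runChunks` / **`Dag.checkChunks parts r`** — the same programme over a list of data CHUNKS
  (`parts.flatten` = the node list), each chunk one structural recursion;
* `Dag.treeOf nodes i : Tree` — the unfolded tree below node `i` (well-founded on `i`; never evaluated).
KERNEL NOTES (measured on the farm, this seat): the store argument of `set` is matched, the statistics of
each state are forced when stored (`Dag.forced`) and the insertion path is re-read at once — without
these the kernel's lazy evaluation fails already at 1.3k states; with them K = 16 (1 261 states, 151-digit
σ) and K = 24 (2 043 states, 255 digits) pass in one declaration, while K = 28/32 exceed the kernel's
memory bound in one declaration ("(kernel) excessive memory consumption") and are certified in BANDS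
(`StretchingLaminateDagBand.lean`). SOUNDNESS (`checkChunks = true ⇒ (treeOf …).cert r = true ⇒ r ≤ C⋆`)
is `StretchingLaminateDagSound.lean`; certificates of record are `StretchingLaminateDagRecord*.lean`.
[ours; bookkeeping. No literature claim.]
-/

namespace Summit.NavierStokesRegularity.FunctionalMining

namespace Laminate

/-- Decidable equality of rational velocity gradients, entry by entry (used by the checker to compare a
stored state with a pushed state; reduces in the kernel). [ours; bookkeeping] -/
instance Grad.instDecidableEq : DecidableEq Grad := fun a b =>
  if h : a.g00 = b.g00 ∧ a.g01 = b.g01 ∧ a.g02 = b.g02 ∧ a.g10 = b.g10 ∧ a.g11 = b.g11 ∧ a.g12 = b.g12 ∧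
      a.g20 = b.g20 ∧ a.g21 = b.g21 ∧ a.g22 = b.g22 then
    isTrue (by
      obtain ⟨_, _, _, _, _, _, _, _, _⟩ := a
      obtain ⟨_, _, _, _, _, _, _, _, _⟩ := b
      simp only at h
      obtain ⟨h1, h2, h3, h4, h5, h6, h7, h8, h9⟩ := h
      subst h1 h2 h3 h4 h5 h6 h7 h8 h9
      rfl)
  else isFalse (fun hab => h (by subst hab; exact ⟨rfl, rfl, rfl, rfl, rfl, rfl, rfl, rfl, rfl⟩))

/-! ## 1. Weight-linearity of the tree statistics (the reason state-indexing works) -/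

namespace Tree

/-- `stretchFrom G W t = W · stretchFrom G 1 t`. [ours; bookkeeping] -/
theorem stretchFrom_eq_mul (t : Tree) (G : Grad) (W : ℚ) :
    t.stretchFrom G W = W * t.stretchFrom G 1 := by
  induction t generalizing G W with
  | leaf => simp [stretchFrom]
  | node s p m ihp ihm =>
    simp only [stretchFrom]
    rw [ihp _ (W * s.lam), ihm _ (W * (1 - s.lam)), ihp _ (1 * s.lam), ihm _ (1 * (1 - s.lam))]
    ring

/-- `energyFrom G W t = W · energyFrom G 1 t`. [ours; bookkeeping] -/
theorem energyFrom_eq_mul (t : Tree) (G : Grad) (W : ℚ) :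
    t.energyFrom G W = W * t.energyFrom G 1 := by
  induction t generalizing G W with
  | leaf => simp [energyFrom]
  | node s p m ihp ihm =>
    simp only [energyFrom]
    rw [ihp _ (W * s.lam), ihm _ (W * (1 - s.lam)), ihp _ (1 * s.lam), ihm _ (1 * (1 - s.lam))]
    ring

end Tree

namespace Dag

/-! ## 2. DAG nodes and the random-access store -/

/-- A child reference: a leaf, or an EARLIER node of the DAG by index. [ours; bookkeeping] -/
inductive Child where
  /-- a leaf child (evaluated in place from the pushed state) -/
  | lf : Child
  /-- the node with index `j` (must be smaller than the referencing node's index) -/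
  | nd : ℕ → Child

/-- An internal node of a lamination DAG: absolute incoming state, split, children. [ours; bookkeeping] -/
structure Node where
  /-- absolute incoming velocity gradient at this state -/
  G : Grad
  /-- split data -/
  s : Split
  /-- `+` child (weight `λ`) -/
  p : Child
  /-- `−` child (weight `1 − λ`) -/
  m : Child

/-- The per-state summary stored by the dynamic programme: state and the three statistics of the
sub-laminate below it (unit weight). [ours; bookkeeping] -/
structure Val where
  /-- the state -/
  G : Grad
  /-- `stretchFrom G 1 (subtree)` -/
  sig : ℚ
  /-- `energyFrom G 1 (subtree)` -/
  en : ℚ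
  /-- `vortSupFrom G (subtree)` -/
  vs : ℚ

/-- A binary-trie store indexed by natural numbers (little-endian bit paths: `0` = here, odd = left
with `i / 2`, even ≠ 0 = right with `i / 2`). [ours; bookkeeping] -/
inductive Store where
  /-- empty store -/
  | nil : Store
  /-- a trie node: value at this address, left and right sub-tries -/
  | br : Option Val → Store → Store → Store

namespace Store

/-- value at the root address. [ours; bookkeeping] -/
def val? : Store → Option Val
  | nil => none
  | br v _ _ => v

/-- left sub-trie. [ours; bookkeeping] -/
def left : Store → Store
  | nil => nil
  | br _ l _ => l

/-- right sub-trie. [ours; bookkeeping] -/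
def right : Store → Store
  | nil => nil
  | br _ _ r => r

/-- lookup (structural on the trie). [ours; bookkeeping] -/
def get : Store → ℕ → Option Val
  | nil, _ => none
  | br v l r, i => if i = 0 then v else if i % 2 = 1 then l.get (i / 2) else r.get (i / 2)

/-- insertion with recursion fuel (any `fuel > log₂ i` suffices; callers use `i + 1`). The store argument
is MATCHED (not projected) so that the kernel's lazy evaluation never builds projection chains. [ours; bookkeeping] -/
def set : ℕ → Store → ℕ → Val → Store
  | 0, st, _, _ => st
  | fuel + 1, nil, i, x =>
    if i = 0 then br (some x) nil nil
    else if i % 2 = 1 then br none (set fuel nil (i / 2) x) nil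
    else br none nil (set fuel nil (i / 2) x)
  | fuel + 1, br v l r, i, x =>
    if i = 0 then br (some x) l r
    else if i % 2 = 1 then br v (set fuel l (i / 2) x) r
    else br v l (set fuel r (i / 2) x)

/-- The two constructor cases of `set` in one projection form. [ours; bookkeeping] -/
theorem set_succ_eq (fuel : ℕ) (st : Store) (i : ℕ) (x : Val) :
    set (fuel + 1) st i x =
      if i = 0 then br (some x) st.left st.right
      else if i % 2 = 1 then br st.val? (set fuel st.left (i / 2) x) st.right
      else br st.val? st.left (set fuel st.right (i / 2) x) := by
  cases st <;> rfl

/-- Rebuilding a node from its projections does not change lookups at `j ≠ 0`. [ours; bookkeeping] -/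
theorem get_br_left_right (v : Option Val) (st : Store) (j : ℕ) :
    (br v st.left st.right).get j = if j = 0 then v else st.get j := by
  cases st with
  | nil => simp [get, left, right]
  | br v' l r => by_cases hj : j = 0 <;> simp [get, left, right, hj]

/-- Address `0` is the root value. [ours; bookkeeping] -/
theorem get_zero_eq_val? (st : Store) : st.get 0 = st.val? := by
  cases st <;> simp [get, val?]

/-- Lookup at `j ≠ 0` descends by parity. [ours; bookkeeping] -/
theorem get_br_val (st l r : Store) (j : ℕ) (hj : j ≠ 0) :
    (br st.val? l r).get j = if j % 2 = 1 then l.get (j / 2) else r.get (j / 2) := by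
  simp [get, hj]

/-- Lookup at `j ≠ 0` in terms of the sub-tries. [ours; bookkeeping] -/
theorem get_of_ne_zero (st : Store) (j : ℕ) (hj : j ≠ 0) :
    st.get j = if j % 2 = 1 then st.left.get (j / 2) else st.right.get (j / 2) := by
  cases st with
  | nil => simp [get, left, right]
  | br v l r => simp [get, left, right, hj]

/-- **Specification of the store:** after `set (fuel+1) st i x` with `i < 2^fuel`, address `i` holds `x`
and every other address is unchanged. [ours; bookkeeping] -/
theorem get_set (fuel : ℕ) (st : Store) (i : ℕ) (x : Val) (j : ℕ) (hi : i < 2 ^ fuel) :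
    (set (fuel + 1) st i x).get j = if j = i then some x else st.get j := by
  induction fuel generalizing st i j with
  | zero =>
    have hi0 : i = 0 := by omega
    subst hi0
    simp only [set_succ_eq, ↓reduceIte, get_br_left_right]
  | succ fuel ih =>
    by_cases hi0 : i = 0
    · subst hi0
      simp only [set_succ_eq, ↓reduceIte, get_br_left_right]
    · rw [set_succ_eq, if_neg hi0]
      have hi2 : i / 2 < 2 ^ fuel := by
        rw [pow_succ] at hi; omega
      by_cases hodd : i % 2 = 1
      · rw [if_pos hodd]
        by_cases hj0 : j = 0
        · subst hj0
          have h0i : (0 : ℕ) ≠ i := Ne.symm hi0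
          simp [get, get_zero_eq_val?, val?, h0i]
        · rw [get_br_val _ _ _ _ hj0, ih _ _ _ hi2, get_of_ne_zero st j hj0]
          by_cases hjo : j % 2 = 1
          · simp only [hjo, ↓reduceIte]
            by_cases hji : j = i
            · subst hji; simp
            · have : j / 2 ≠ i / 2 := by omega
              simp [this, hji]
          · have hji : j ≠ i := by omega
            simp [hjo, hji]
      · rw [if_neg hodd]
        by_cases hj0 : j = 0
        · subst hj0
          have h0i : (0 : ℕ) ≠ i := Ne.symm hi0
          simp [get, get_zero_eq_val?, val?, h0i]
        · rw [get_br_val _ _ _ _ hj0, ih _ _ _ hi2, get_of_ne_zero st j hj0]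
          by_cases hjo : j % 2 = 1
          · have hji : j ≠ i := by omega
            simp [hjo, hji]
          · simp only [hjo, ↓reduceIte]
            by_cases hji : j = i
            · subst hji; simp
            · have : j / 2 ≠ i / 2 := by omega
              simp [this, hji]

/-- The instance used by the checker: fuel `i + 1` always suffices. [ours; bookkeeping] -/
theorem get_set_succ (st : Store) (i : ℕ) (x : Val) (j : ℕ) :
    (set (i + 1) st i x).get j = if j = i then some x else st.get j :=
  get_set i st i x j (Nat.lt_two_pow_self)

end Store

/-! ## 3. The dynamic programme (kernel-evaluated) -/

/-- The summary of a child: a leaf is evaluated in place at the pushed state `Gc`; a node reference `j`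
must be earlier (`j < i`) and its stored state must equal `Gc`. [ours; bookkeeping] -/
def childVal (st : Store) (i : ℕ) (Gc : Grad) : Child → Option Val
  | .lf => some ⟨Gc, Gc.stretch, Gc.halfGradSq, Gc.vortSq⟩
  | .nd j => if j < i then
      match st.get j with
      | some v => if v.G = Gc then some v else none
      | none => none
    else none

/-- Combine the two children of a split at state `G`. [ours; bookkeeping] -/
def combine (G : Grad) (s : Split) (vp vm : Val) : Val :=
  ⟨G, s.lam * vp.sig + (1 - s.lam) * vm.sig, s.lam * vp.en + (1 - s.lam) * vm.en,
    if vp.vs ≤ vm.vs then vm.vs else vp.vs⟩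

/-- Touch numerator and denominator of the three statistics (always `true`): makes the kernel's lazy
evaluation compute each state's statistics when the state is stored, so that no deep unevaluated
arithmetic accumulates along DAG paths. [ours; bookkeeping] -/
def forced (v : Val) : Bool :=
  decide (v.sig.num = v.sig.num) && decide (v.sig.den = v.sig.den) && decide (v.en.num = v.en.num)
    && decide (v.en.den = v.en.den) && decide (v.vs.num = v.vs.num) && decide (v.vs.den = v.vs.den)

/-- One step of the programme at node index `i`. [ours; bookkeeping] -/
def step (i : ℕ) (st : Store) (nd : Node) : Option Store :=
  if 0 < nd.s.lam ∧ nd.s.lam < 1 ∧ nd.s.c0 * nd.s.n0 + nd.s.c1 * nd.s.n1 + nd.s.c2 * nd.s.n2 = 0 then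
    match childVal st i (nd.G.layer (1 - nd.s.lam) nd.s) nd.p,
      childVal st i (nd.G.layer (-nd.s.lam) nd.s) nd.m with
    | some vp, some vm =>
      if forced (combine nd.G nd.s vp vm) then
        -- re-read the freshly stored state: forces the kernel to evaluate the insertion path now
        match (st.set (i + 1) i (combine nd.G nd.s vp vm)).get i with
        | some _ => some (st.set (i + 1) i (combine nd.G nd.s vp vm))
        | none => none
      else none
    | _, _ => none
  else none

/-- Run the programme over the node list (index of the head = `i`). [ours; bookkeeping] -/
def run : List Node → ℕ → Store → Option Store
  | [], _, st => some st
  | nd :: rest, i, st =>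
    match step i st nd with
    | none => none
    | some st' => run rest (i + 1) st'

/-- The final test on the root summary: root state `0`, signs, and `r² E² M² ≤ σ²` — literally the
conjuncts of `Tree.cert`. [ours; bookkeeping] -/
def rootOk (v : Val) (r : ℚ) : Bool :=
  decide (v.G = Grad.zero) && decide (0 < r) && decide (0 < v.sig) && decide (0 ≤ v.en)
    && decide (0 ≤ v.vs) && decide (r * r * (v.en * v.en) * v.vs ≤ v.sig * v.sig)

/-- **The DAG certificate checker** (root = LAST node). [ours; bookkeeping] -/
def check (nodes : List Node) (r : ℚ) : Bool :=
  match run nodes 0 Store.nil with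
  | none => false
  | some st =>
    match st.get (nodes.length - 1) with
    | none => false
    | some v => rootOk v r

/-! ## 4. The unfolded tree and the soundness theorem -/

/-- The unfolded lamination tree below node `i` (a dangling or forward reference unfolds to a leaf —
irrelevant, since `check` rejects such DAGs). Well-founded on `i`; for PROOFS only. [ours; bookkeeping] -/
def treeOf (nodes : List Node) (i : ℕ) : Tree :=
  match nodes[i]? with
  | none => .leaf
  | some nd =>
    .node nd.s
      (match nd.p with
        | .lf => .leaf
        | .nd j => if _h : j < i then treeOf nodes j else .leaf)
      (match nd.m with
        | .lf => .leaf
        | .nd j => if _h : j < i then treeOf nodes j else .leaf)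
termination_by i

/-- The tree a child reference of node `i` unfolds to. [ours; bookkeeping] -/
def childTree (nodes : List Node) (i : ℕ) : Child → Tree
  | .lf => .leaf
  | .nd j => if j < i then treeOf nodes j else .leaf

/-- Unfolding equation of `treeOf` at a present node. [ours; bookkeeping] -/
theorem treeOf_eq (nodes : List Node) (i : ℕ) (nd : Node) (h : nodes[i]? = some nd) :
    treeOf nodes i = .node nd.s (childTree nodes i nd.p) (childTree nodes i nd.m) := by
  rw [treeOf, h]
  simp only [childTree, dite_eq_ite]

end Dag

end Laminate

end Summit.NavierStokesRegularity.FunctionalMining
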